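/-
Copyright: the b2b-balaban T⁴-continuum CRUX team, row NE7b OWNER lineage `t4-ne7b-p1` (gen 125). Project licence.
-/
import Summits.QuantumFields.BalabanUV.T4Continuum.Spine.NE7b.SupZdSoftStepComposition

/-!
# THE COMPOSED SOFT COUPLINGS STAY IN `[a(1 − 1∕m), a]`: iterating (252)'s composition law `a′ = a₁a₂m∕(a₁m + a₂)` with equal one-step
# couplings `a` and block volume `m > 1` — `c₀ = a`, `c_{k+1} = c_k·a·m∕(c_k·m + a)` (the `k+1`-fold composite read as inner coupling `c_k` under one
# more outer step) — gives `1∕c_k = (1∕a)Σ_{j ≤ k}m^{−j}` in closed form, hence `a(m − 1)∕m < c_k ≤ a`, `c_{k+1} ≤ c_k`: the couplings of ALL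
# iterates lie in a compact interval of relative width `1∕m = (n+1)^{−d}` below `a` — the INPUT interval of the successor's `a`-uniformity audit
# ((c3) of the decision recorded in (251)): the column's constants need uniformity only over `a ∈ [a(1 − (n+1)^{−d}), a]` (row NE7b, node U5c;
# (252) BY NAME; [folklore])

Cell `pub-balaban`, sub-cell `t4`, spine estimate NE7b (`T4WeightBudget.RelWeightBound`; the cell's OWN estimate — NOT PRINTED in
[Bałaban 1983–89], NOT PROVED).  Crux-route work under `Spine/NE7b/` by the row OWNER (`t4-ne7b-p1` gen 125, file (255)) under FREEZE
(0)'s crux-prover clause; NOTHING of Bałaban's is named as a Lean object, valued or asserted; no `T4Continuum/Support` leaf typed; no `def`,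
no notation (the coupling sequence is ANY `c : ℕ → ℝ` with the displayed recursion — no definition); zero `sorry`.  Imports (BY NAME): the
OWNER's (252) `…SupZdSoftStepComposition` (`scalar_pair_min`, for the toy; through it (251)∕(27)), Mathlib's `Finset.sum_range_succ`,
`geom_sum_eq`, `field_simp`.

WHY (located).  (251)∕(252) reduced § [NE7bP1-G123-HANDOFF] NEXT (3)(c) to (c3): are the column's constants `C₀, C_P, δ₀, c₁, δ₁` (today
`∃`-constants «from (d, a, λ, Λ)») uniform in the block coupling along the composed steps?  The answer needs the RANGE of the composed couplings
first.  In (252)'s normalisation (weights absorbed), `k+1` equal soft steps of coupling `a` on blocks of `m = (n+1)^d` sites compose to ONE soft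
step of coupling `c_k` with `1∕c_k = (1∕a)(1 + m^{−1} + ⋯ + m^{−k})`, a geometric sum: the couplings DECREASE but never below `a(1 − 1∕m)`.  So the audit
is over an interval of relative width `(n+1)^{−d} ≤ 2^{−d}` below `a`, on which `λ < min(2, a(1 − 2^{−d}))` keeps every hypothesis of (130)–(254) in force
— recorded for the successor, who decides whether the `∃`-constants can be chosen continuously∕monotonically in `a` there (most are built from
`min(2,a) − λ` and `a + Λ`).

WHAT IS PROVED ([folklore]): §1 `inv_step` (the recursion inverts to `1∕c_{k+1} = 1∕a + 1∕(c_km)`), **`soft_coupling_closed_form`**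
(`(c_k)⁻¹ = a⁻¹Σ_{j < k+1}(m⁻¹)^j`, positivity of every `c_k`); §2 **`soft_coupling_bounds`** (`a(m − 1)∕m < c_k ≤ a` and `c_{k+1} ≤ c_k`); §3 READ
ON `ℤ^d`: **`zd_soft_coupling_bounds`** (`m = (n+1)^d`, `n ≥ 1`: `a(1 − (n+1)^{−d}) < c_k ≤ a`); §4 toy.

HONEST (what this is NOT).  Real arithmetic of the coupling recursion only; which normalisation of the road's `a`-term matches (252)'s
(weights of the two levels) is the successor's bookkeeping, as is the audit itself; nothing of Bałaban's asserted.  BY-NAME EFFECT ON THE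
WALL: NONE.  NE7b NOT PRINTED ∕ NOT PROVED; spine PROVED 0∕9; rung (B)+1 — the programme's measures remain FINITE-torus statements; NOT the
mass gap, NOT Clay.  HONEST DEPENDENCY: continuum YM on T⁴ ⇐ BetaPertH ∧ nine spine estimates (0∕9 proved); BetaPertH ⇐ (D1) ∧ (D4) ∧
CAP+tail; G-an2-4 gates asym, D1 and NE2∕3∕4.
-/

set_option autoImplicit false

noncomputable section

namespace Summit.QuantumFields.BalabanUV.T4Continuum.NE7b.SupZdSoftStepCouplings

open Literature.MathematicalPhysics.QuantumFieldTheory.Balaban1983to89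
open SupZdSoftStepComposition (scalar_pair_min)

/-! ## §1. The recursion inverts to a geometric sum -/

/-- **ONE STEP OF THE RECURSION, INVERTED**: `c > 0`, `a > 0`, `m > 0`, `c′ = c·a·m∕(c·m + a)` ⟹ `c′ > 0` and `1∕c′ = 1∕a + 1∕(c·m)`. [folklore] -/
theorem inv_step {a m c c' : ℝ} (ha : 0 < a) (hm : 0 < m) (hc : 0 < c) (h : c' = c * a * m / (c * m + a)) :
    0 < c' ∧ c'⁻¹ = a⁻¹ + (c * m)⁻¹ := by
  have hden : 0 < c * m + a := by positivity
  refine ⟨by rw [h]; positivity, ?_⟩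
  rw [h]
  field_simp

/-- **CLOSED FORM**: `c₀ = a`, `c_{k+1} = c_k·a·m∕(c_k·m + a)` (`a, m > 0`) ⟹ every `c_k > 0` and `(c_k)⁻¹ = a⁻¹·Σ_{j < k+1}(m⁻¹)^j`. [folklore] -/
theorem soft_coupling_closed_form {a m : ℝ} (ha : 0 < a) (hm : 0 < m) (c : ℕ → ℝ) (h0 : c 0 = a)
    (hsucc : ∀ k, c (k + 1) = c k * a * m / (c k * m + a)) (k : ℕ) :
    0 < c k ∧ (c k)⁻¹ = a⁻¹ * ∑ j ∈ Finset.range (k + 1), (m⁻¹) ^ j := by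
  induction k with
  | zero => exact ⟨by rw [h0]; exact ha, by rw [h0, Finset.sum_range_one, pow_zero, mul_one]⟩
  | succ k ih =>
    obtain ⟨hpos, hinv⟩ := inv_step ha hm ih.1 (hsucc k)
    refine ⟨hpos, ?_⟩
    rw [hinv, mul_inv, ih.2, Finset.sum_range_succ' (fun j => (m⁻¹ : ℝ) ^ j) (k + 1), pow_zero]
    simp only [pow_succ]
    rw [← Finset.sum_mul]
    ring

/-! ## §2. Bounds: the couplings decrease but stay above `a(m − 1)∕m` -/

/-- **BOUNDS ON THE COMPOSED COUPLINGS** (`a > 0`, `m > 1`): `a(m − 1)∕m < c_k ≤ a` and `c_{k+1} ≤ c_k` — the geometric sum lies in `[1, m∕(m−1))`.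
[folklore] -/
theorem soft_coupling_bounds {a m : ℝ} (ha : 0 < a) (hm : 1 < m) (c : ℕ → ℝ) (h0 : c 0 = a)
    (hsucc : ∀ k, c (k + 1) = c k * a * m / (c k * m + a)) (k : ℕ) :
    a * (m - 1) / m < c k ∧ c k ≤ a ∧ c (k + 1) ≤ c k := by
  have hm0 : 0 < m := by linarith
  have hm1 : 0 < m - 1 := by linarith
  obtain ⟨hpos, hinv⟩ := soft_coupling_closed_form ha hm0 c h0 hsucc k
  obtain ⟨S, hS⟩ : ∃ S : ℝ, S = ∑ j ∈ Finset.range (k + 1), (m⁻¹ : ℝ) ^ j := ⟨_, rfl⟩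
  rw [← hS] at hinv
  -- the geometric sum: `1 ≤ S < m∕(m − 1)`
  have hS1 : 1 ≤ S := by
    rw [hS, Finset.sum_range_succ']
    simp only [pow_zero]
    have : 0 ≤ ∑ j ∈ Finset.range k, (m⁻¹ : ℝ) ^ (j + 1) := Finset.sum_nonneg fun j _ => by positivity
    linarith
  have hSpos : 0 < S := by linarith
  have hSm : S * (m - 1) < m := by
    have hg : S * (1 - m⁻¹) = 1 - (m⁻¹) ^ (k + 1) := by rw [hS]; exact geom_sum_mul_neg (m⁻¹ : ℝ) (k + 1)
    have hpk : 0 < (m⁻¹ : ℝ) ^ (k + 1) := pow_pos (by positivity) _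
    have hmq : m * m⁻¹ = 1 := mul_inv_cancel₀ hm0.ne'
    have e : S * (m - 1) = m * (S * (1 - m⁻¹)) := by linear_combination S * hmq
    rw [e, hg]
    nlinarith [mul_pos hm0 hpk]
  -- `c_k = a·S⁻¹`
  have hck : c k = a * S⁻¹ := by
    have h := congrArg Inv.inv hinv
    rw [inv_inv, mul_inv, inv_inv] at h
    exact h
  refine ⟨?_, ?_, ?_⟩
  · rw [hck, div_lt_iff₀ hm0]
    have h3 : a * (m - 1) * S < a * m := by nlinarith [mul_pos ha hSpos]
    calc a * (m - 1) = a * (m - 1) * S * S⁻¹ := by field_simp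
      _ < a * m * S⁻¹ := mul_lt_mul_of_pos_right h3 (inv_pos.2 hSpos)
      _ = a * S⁻¹ * m := by ring
  · rw [hck]
    exact mul_le_of_le_one_right ha.le (inv_le_one_of_one_le₀ hS1)
  · obtain ⟨hpos', hinv'⟩ := inv_step ha hm0 hpos (hsucc k)
    have h : (c k)⁻¹ ≤ (c (k + 1))⁻¹ := by
      rw [hinv', mul_inv, hinv]
      have hmq : m * m⁻¹ = 1 := mul_inv_cancel₀ hm0.ne'
      have ha' : 0 < a⁻¹ := inv_pos.2 ha
      have h1 : S - S * m⁻¹ < 1 := by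
        have h4 := mul_lt_mul_of_pos_right hSm (inv_pos.2 hm0)
        have e : S * (m - 1) * m⁻¹ = S - S * m⁻¹ := by linear_combination S * hmq
        rw [e, hmq] at h4
        exact h4
      nlinarith [mul_lt_mul_of_pos_left h1 ha']
    exact (inv_le_inv₀ hpos hpos').1 h

/-! ## §3. Read on `ℤ^d`: `m = (n+1)^d` -/

/-- **THE COMPOSED COUPLINGS ON `ℤ^d`** (`n ≥ 1`, `d ≥ 1`, so `m = (n+1)^d > 1`): for `c₀ = a > 0`, `c_{k+1} = c_k·a·(n+1)^d∕(c_k(n+1)^d + a)`: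
`a(1 − (n+1)^{−d}) < c_k ≤ a` and `c_{k+1} ≤ c_k` for every `k` — the audit interval of (c3). [folklore] -/
theorem zd_soft_coupling_bounds {d : ℕ} (hd : 1 ≤ d) (n : ℕ) (hn : 1 ≤ n) {a : ℝ} (ha : 0 < a) (c : ℕ → ℝ) (h0 : c 0 = a)
    (hsucc : ∀ k, c (k + 1) = c k * a * ((n : ℝ) + 1) ^ d / (c k * ((n : ℝ) + 1) ^ d + a)) (k : ℕ) :
    a * (1 - (((n : ℝ) + 1) ^ d)⁻¹) < c k ∧ c k ≤ a ∧ c (k + 1) ≤ c k := by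
  have hm : 1 < ((n : ℝ) + 1) ^ d := by
    have h2 : (2 : ℝ) ≤ (n : ℝ) + 1 := by
      have : (1 : ℝ) ≤ n := by exact_mod_cast hn
      linarith
    calc (1 : ℝ) < 2 := one_lt_two
      _ = 2 ^ 1 := (pow_one _).symm
      _ ≤ 2 ^ d := pow_le_pow_right₀ one_le_two hd
      _ ≤ ((n : ℝ) + 1) ^ d := pow_le_pow_left₀ zero_le_two h2 d
  obtain ⟨h1, h2, h3⟩ := soft_coupling_bounds ha hm c h0 hsucc k
  refine ⟨?_, h2, h3⟩
  have hm0 : (0 : ℝ) < ((n : ℝ) + 1) ^ d := by positivity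
  have e : a * (1 - (((n : ℝ) + 1) ^ d)⁻¹) = a * (((n : ℝ) + 1) ^ d - 1) / ((n : ℝ) + 1) ^ d := by
    field_simp
  rw [e]
  exact h1

/-! ## §4. Toy -/

/-- Toy: `a = 1`, `m = 2`: two steps compose to `c₁ = 1·1·2∕(1·2 + 1) = 2∕3`, and indeed `1∕c₁ = 1 + 1∕2`. -/
example : ((1 : ℝ) * 1 * 2 / (1 * 2 + 1))⁻¹ = (1 : ℝ)⁻¹ + (1 * 2)⁻¹ :=
  (inv_step (a := 1) (m := 2) (c := 1) one_pos two_pos one_pos rfl).2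

end Summit.QuantumFields.BalabanUV.T4Continuum.NE7b.SupZdSoftStepCouplings
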